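import Summits.Ventures.HodgeRepro2.T5SU11JacobiPhaseMomentsAsymptotic

/-!
# The rescaled phase converges in law to the standard exponential law, for every `λ`

`T5SU11JacobiPhaseMomentsAsymptotic` gives the convergence of every moment of `k · log|a|` under the
probability measure `m_k φ_λ dν/m̂_k(λ)` to those of `Exp(1)`. This file gives the convergence IN LAW,
in the phase variable: with the Laplace form `m̂_k(λ) = 2π ∫_0^∞ e^{−(k−2)s} Φ_λ(s) ds` the tail at `x/k` is

  `T_{k,λ}(x) := 2π ∫_{x/k}^∞ e^{−(k−2)s} Φ_λ(s) ds / m̂_k(λ)`,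

and, for every real `λ` and every `x ≥ 0`,

  **`T_{k,λ}(x) → e^{−x}` as `k → ∞`**   (`tendsto_phase_tail_atTop`):

the substitution `s = u/(k − 2)` (`tail_phase_eq`) turns the numerator into
`(2π/(k − 2)) ∫_{x(k−2)/k}^∞ e^{−u} Φ_λ(u/(k − 2)) du`, the integral tends to `∫_x^∞ e^{−u} du = e^{−x}` by
dominated convergence (`tendsto_tail_integral`: the domain `(x(k−2)/k, ∞)` converges to `(x, ∞)`, the
indicators converge off the single point `u = x`, the domination is the phase bound of
`T5SU11JacobiPhaseMomentsAsymptotic`), and `(k − 2) m̂_k(λ) → 2π` (`tendsto_sub_two_mul_jacobi_weight`).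
At `λ = 0` the tail is exactly `e^{−(k−2)x/k}` (`T5SU11PhaseTail`, the exponential law of rate `k − 2`), and
the group-side reading of `T_{k,λ}` as the `ν`-measure of `{k·log|a(g)| > x}` for `m_k φ_λ dν/m̂_k(λ)` is
the law of the phase (`T5SU11PhaseTail.lintegral_phase_eq_measurable`), not re-derived here. Nothing is
claimed about (N).

Blind lane: Mathlib + the HodgeRepro2 prefix only; no sorry; axioms ⊆ {propext, Classical.choice,
Quot.sound}.
-/

namespace Summit.Ventures.HodgeRepro2.T5SU11JacobiPhaseLawAsymptotic

open MeasureTheory MeasureTheory.Measure Metric Set Filter Topology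
open T5SU11Unimodular T5SU11Fibration T5SU11Cartan T5SU11OneParameter T5SU11CartanProjection T5HaarCircle
  T5BergmanCoefficient T5SU11FibrationHaar T5SU11SphericalFunction T5SU11SphericalSymmetry
  T5SU11SphericalBounds T5SU11SphericalContinuous T5SU11JacobiIwasawa T5SU11JacobiTransform
  T5SU11JacobiWeight T5SU11KFiniteMajorantPow T5SU11JacobiWeightDeriv T5SU11PhaseLaw
  T5SU11PhaseLawLintegral T5SU11JacobiLaplacePhase T5SU11JacobiWeightDerivAll
  T5SU11JacobiWeightAsymptotic T5SU11SphericalGrowth T5SU11JacobiPhaseMomentsAsymptotic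
open scoped Real

/-! ### Elementary limits -/

/-- `x(k − 2)/k → x` as `k → ∞`. -/
theorem tendsto_mul_sub_two_div (x : ℝ) : Tendsto (fun k : ℝ => x * (k - 2) / k) atTop (𝓝 x) := by
  have h0 : Tendsto (fun k : ℝ => 2 * x / k) atTop (𝓝 0) := tendsto_id.const_div_atTop (2 * x)
  have h1 : Tendsto (fun k : ℝ => x - 2 * x / k) atTop (𝓝 (x - 0)) := tendsto_const_nhds.sub h0
  rw [sub_zero] at h1
  refine h1.congr' ?_
  filter_upwards [eventually_gt_atTop (0 : ℝ)] with k hk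
  have : k ≠ 0 := hk.ne'
  field_simp

/-- `e^{−u/2}` is integrable on `(0, ∞)`. -/
theorem integrableOn_exp_neg_half_Ioi : IntegrableOn (fun u : ℝ => Real.exp (-(u / 2))) (Ioi 0) := by
  have h := integrableOn_pow_mul_exp_neg_half_Ioi 0
  simpa only [pow_zero, one_mul] using h

/-- `∫_x^∞ e^{−u} du = e^{−x}`, written on `(0, ∞)` with the indicator of `(x, ∞)`, for `x ≥ 0`. -/
theorem integral_indicator_exp_neg {x : ℝ} (hx : 0 ≤ x) :
    ∫ u in Ioi (0 : ℝ), (Ioi x).indicator (fun u => Real.exp (-u)) u = Real.exp (-x) := by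
  rw [integral_indicator measurableSet_Ioi, Measure.restrict_restrict measurableSet_Ioi,
    Ioi_inter_Ioi, show max x 0 = x from max_eq_left hx, integral_exp_neg_Ioi]

section measure

variable [MeasurableSpace Circle] [BorelSpace Circle]

/-- `(k − 2) · m̂_k(λ) → 2π` (from `k · m̂_k(λ) → 2π` and `m̂_k(λ) → 0`). -/
theorem tendsto_sub_two_mul_jacobi_weight (lam : ℝ) :
    Tendsto (fun k : ℝ => (k - 2) * ∫ g, (1 - ‖orbit g‖ ^ 2) ^ (k / 2) * sph lam g ∂(nu haarCircle))
      atTop (𝓝 (2 * π)) := by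
  have h := (tendsto_mul_jacobi_weight lam).sub ((tendsto_jacobi_weight_atTop_zero lam).const_mul 2)
  rw [mul_zero, sub_zero] at h
  refine h.congr' (Filter.Eventually.of_forall fun k => ?_)
  simp only
  ring

/-! ### The substitution in the tail -/

omit [BorelSpace Circle] in
/-- **The tail after the substitution `s = u/(k − 2)`**: for `k > 2` and `x ≥ 0`,
`∫_{x/k}^∞ e^{−(k−2)s} Φ_λ(s) ds = (k − 2)⁻¹ ∫_{x(k−2)/k}^∞ e^{−u} Φ_λ(u/(k − 2)) du`. -/
theorem tail_phase_eq (lam : ℝ) {k : ℝ} (hk : 2 < k) (x : ℝ) :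
    ∫ s in Ioi (x / k), Real.exp (-((k - 2) * s)) * sphPhase lam s
      = (k - 2)⁻¹ * ∫ u in Ioi (x * (k - 2) / k), Real.exp (-u) * sphPhase lam (u / (k - 2)) := by
  have hc : 0 < k - 2 := by linarith
  have h := integral_comp_mul_left_Ioi (fun u : ℝ => Real.exp (-u) * sphPhase lam (u / (k - 2)))
    (x / k) hc
  rw [smul_eq_mul, show (k - 2) * (x / k) = x * (k - 2) / k by ring] at h
  rw [← h]
  refine setIntegral_congr_fun measurableSet_Ioi fun s _ => ?_
  rw [mul_div_cancel_left₀ _ hc.ne']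

/-! ### Dominated convergence on the moving domain -/

/-- **`∫_{x(k−2)/k}^∞ e^{−u} Φ_λ(u/(k − 2)) du → e^{−x}`** as `k → ∞`, for every `λ` and `x ≥ 0`. -/
theorem tendsto_tail_integral (lam : ℝ) {x : ℝ} (hx : 0 ≤ x) :
    Tendsto (fun k : ℝ => ∫ u in Ioi (x * (k - 2) / k), Real.exp (-u) * sphPhase lam (u / (k - 2)))
      atTop (𝓝 (Real.exp (-x))) := by
  set C : ℝ := Real.exp (|lam - 1| * Real.log 2) with hC
  -- the integrals over the moving domains as integrals over `(0, ∞)` of indicator functions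
  have hlim := tendsto_integral_filter_of_dominated_convergence (μ := volume.restrict (Ioi (0 : ℝ)))
    (l := atTop)
    (F := fun k u => (Ioi (x * (k - 2) / k)).indicator
      (fun u => Real.exp (-u) * sphPhase lam (u / (k - 2))) u)
    (f := fun u => (Ioi x).indicator (fun u => Real.exp (-u)) u)
    (fun u => C * Real.exp (-(u / 2)))
    (Filter.Eventually.of_forall fun k => ?_) ?_ (integrableOn_exp_neg_half_Ioi.const_mul C) ?_
  · rw [integral_indicator_exp_neg hx] at hlim
    refine hlim.congr' ?_
    filter_upwards [eventually_gt_atTop (2 : ℝ)] with k hk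
    have hxk : 0 ≤ x * (k - 2) / k := by positivity
    rw [integral_indicator measurableSet_Ioi, Measure.restrict_restrict measurableSet_Ioi,
      Ioi_inter_Ioi, show max (x * (k - 2) / k) 0 = x * (k - 2) / k from max_eq_left hxk]
  · exact ((Real.continuous_exp.comp continuous_neg).mul
      ((continuous_sphPhase lam).comp (continuous_id.div_const _))).aestronglyMeasurable.indicator
      measurableSet_Ioi
  · filter_upwards [eventually_gt_atTop (2 + 2 * |lam - 1|)] with k hk
    filter_upwards [ae_restrict_mem measurableSet_Ioi] with u hu
    rw [mem_Ioi] at hu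
    have hk2 : 0 < k - 2 := by linarith [abs_nonneg (lam - 1)]
    have hΦ : sphPhase lam (u / (k - 2)) ≤ C * Real.exp (u / 2) := by
      refine (sphPhase_le_exp lam (div_nonneg hu.le hk2.le)).trans ?_
      refine mul_le_mul_of_nonneg_left (Real.exp_le_exp.mpr ?_) (Real.exp_pos _).le
      rw [mul_div_assoc', div_le_div_iff₀ hk2 two_pos]
      nlinarith [abs_nonneg (lam - 1)]
    have hval : Real.exp (-u) * sphPhase lam (u / (k - 2)) ≤ C * Real.exp (-(u / 2)) := by
      calc Real.exp (-u) * sphPhase lam (u / (k - 2))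
          ≤ Real.exp (-u) * (C * Real.exp (u / 2)) :=
            mul_le_mul_of_nonneg_left hΦ (Real.exp_pos _).le
        _ = C * (Real.exp (-u) * Real.exp (u / 2)) := by ring
        _ = C * Real.exp (-(u / 2)) := by
            rw [← Real.exp_add]
            congr 2
            ring
    have hnn : 0 ≤ Real.exp (-u) * sphPhase lam (u / (k - 2)) :=
      mul_nonneg (Real.exp_pos _).le (sphPhase_pos lam _).le
    by_cases hmem : u ∈ Ioi (x * (k - 2) / k)
    · rw [indicator_of_mem hmem, Real.norm_of_nonneg hnn]
      exact hval
    · rw [indicator_of_notMem hmem, norm_zero]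
      exact mul_nonneg (Real.exp_pos _).le (Real.exp_pos _).le
  · -- pointwise limit off the single point `u = x`
    filter_upwards [Measure.ae_ne (volume.restrict (Ioi (0 : ℝ))) x] with u hu
    have hdiv : Tendsto (fun k : ℝ => u / (k - 2)) atTop (𝓝 0) :=
      tendsto_sub_two_atTop.const_div_atTop u
    have hΦ : Tendsto (fun k : ℝ => Real.exp (-u) * sphPhase lam (u / (k - 2))) atTop
        (𝓝 (Real.exp (-u) * 1)) := by
      have := ((continuous_sphPhase lam).tendsto 0).comp hdiv
      rw [sphPhase_zero] at this
      exact tendsto_const_nhds.mul this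
    rw [mul_one] at hΦ
    rcases lt_or_gt_of_ne hu with hlt | hgt
    · -- `u < x`: eventually `u ≤ x(k−2)/k`, both indicators vanish
      have hev : ∀ᶠ k : ℝ in atTop, u ∉ Ioi (x * (k - 2) / k) := by
        have := (tendsto_mul_sub_two_div x).eventually (eventually_gt_nhds hlt)
        filter_upwards [this] with k hk
        rw [mem_Ioi, not_lt]
        exact hk.le
      have hzero : (Ioi x).indicator (fun u => Real.exp (-u)) u = 0 :=
        indicator_of_notMem (by rw [mem_Ioi, not_lt]; exact hlt.le) _
      rw [hzero]
      refine tendsto_const_nhds.congr' ?_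
      filter_upwards [hev] with k hk
      rw [indicator_of_notMem hk]
    · -- `u > x`: eventually `u > x(k−2)/k`, both indicators are `1`
      have hev : ∀ᶠ k : ℝ in atTop, u ∈ Ioi (x * (k - 2) / k) := by
        have := (tendsto_mul_sub_two_div x).eventually (eventually_lt_nhds hgt)
        filter_upwards [this] with k hk
        exact hk
      have hone : (Ioi x).indicator (fun u => Real.exp (-u)) u = Real.exp (-u) :=
        indicator_of_mem hgt _
      rw [hone]
      refine hΦ.congr' ?_
      filter_upwards [hev] with k hk
      rw [indicator_of_mem hk]

/-! ### The limit law -/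

/-- **THE RESCALED PHASE CONVERGES IN LAW TO `Exp(1)`**: for every `λ` and every `x ≥ 0`,
`T_{k,λ}(x) = 2π ∫_{x/k}^∞ e^{−(k−2)s} Φ_λ(s) ds / m̂_k(λ) → e^{−x}` as `k → ∞`. -/
theorem tendsto_phase_tail_atTop (lam : ℝ) {x : ℝ} (hx : 0 ≤ x) :
    Tendsto (fun k : ℝ =>
        2 * π * (∫ s in Ioi (x / k), Real.exp (-((k - 2) * s)) * sphPhase lam s)
          / ∫ g, (1 - ‖orbit g‖ ^ 2) ^ (k / 2) * sph lam g ∂(nu haarCircle))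
      atTop (𝓝 (Real.exp (-x))) := by
  have hpi : (2 * π : ℝ) ≠ 0 := by positivity
  have hA : Tendsto (fun k : ℝ => 2 * π
      / ((k - 2) * ∫ g, (1 - ‖orbit g‖ ^ 2) ^ (k / 2) * sph lam g ∂(nu haarCircle)))
      atTop (𝓝 (2 * π / (2 * π))) :=
    tendsto_const_nhds.div (tendsto_sub_two_mul_jacobi_weight lam) hpi
  rw [div_self hpi] at hA
  have h := hA.mul (tendsto_tail_integral lam hx)
  rw [one_mul] at h
  refine h.congr' ?_
  filter_upwards [eventually_gt_atTop (max 2 (max lam (2 - lam)))] with k hk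
  rw [max_lt_iff, max_lt_iff] at hk
  have hk2 : k - 2 ≠ 0 := by linarith
  have hm : ∫ g, (1 - ‖orbit g‖ ^ 2) ^ (k / 2) * sph lam g ∂(nu haarCircle) ≠ 0 :=
    (jacobi_pos (by linarith) (by linarith) (by linarith)).ne'
  rw [tail_phase_eq lam hk.1 x]
  field_simp

end measure

end Summit.Ventures.HodgeRepro2.T5SU11JacobiPhaseLawAsymptotic
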